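import Summits.ResolutionOfSingularities.ResolutionOfSingularities.Theorems.ValuativeLupiTranscendentalAscent
import HarnessLib

/-!
# Route `Valuative`, item `Lupi` (stmt-ResolutionOfSingularities-0560): restriction to a subfield, and dropping an idle variable

The reduction "the polynomial `f` in `t ^ p = f(x₁, …, xₙ)` may be assumed to involve every
variable": if `f` does not involve `x_{i₀}`, then `K = K₁(x_{i₀})` is purely transcendental over
the hypersurface function field `K₁ = k(x_i, i ≠ i₀; t)` in ONE FEWER variable, the restriction
`O ∩ K₁` is a valuation ring of `K₁` over `k`, and local uniformization of `O ∩ K₁`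
(an instance of `Lupi` with `n - 1` variables) ascends to `O` by
`isLocallyUniformizable_of_adjoin_model` (`ValuativeLupiTranscendentalAscent.lean`).

* `mk_mem_maximalIdeal_comap_iff` — the centre of `O` restricts to the centre of `O ∩ K₁`.
* `exists_model_of_intermediateField` — a locally uniformizing model of `(K₁, O ∩ K₁)` is, inside
  `K`, a finitely generated `k`-subalgebra `A₀ ⊆ O ∩ K₁` regular at the centre of `O` with
  `K₁ ⊆ k(A₀)` (transport of the local ring along `A ≅ A.map (K₁ ↪ K)`).
* `isLocallyUniformizable_of_intermediateField` — LU of `O ∩ K₁` plus `r` further generators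
  with `trdeg_k K₁ + r ≤ trdeg_k K` give LU of `O`.
* `datum_restrict` — a `Lupi` datum `(x₁, t₁)` of `K` lying in the subfield `K₁ = k(x₁, t₁)` is a
  `Lupi` datum of `K₁`.
* `isLocallyUniformizable_of_drop` — the variable-dropping step, with the smaller instance of
  `Lupi` as a hypothesis (used inductively in `ValuativeLupiReductions.lean`).

Log: (1) direct; Mathlib `IntermediateField.lift_adjoin` / `lift_top`, `AlgebraicIndependent.of_comp`,
`Subring.equivMapOfInjective`, `ValuationSubring.comap`, `trdeg_le_of_injective`.
-/

-- single-problem summit: the doubled namespace component `ResolutionOfSingularities` is forced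
set_option linter.dupNamespace false

open IsLocalRing

namespace Summit.ResolutionOfSingularities.ResolutionOfSingularities.Theorems.Lupi

open Literature.AlgebraicGeometry.Resolution

/-! ## Transport of a locally uniformizing model from a subfield -/

section Transport

variable {k K : Type} [Field k] [Field K] [Algebra k K]

/-- The centre restricts: for `f : K₁ → K` and `a ∈ O ∩ K₁ = O.comap f`, `a` lies in the maximal
ideal of `O.comap f` iff `f a` lies in the maximal ideal of `O`. -/
theorem mk_mem_maximalIdeal_comap_iff {K₁ : Type} [Field K₁] (O : ValuationSubring K)
    (f : K₁ →+* K) {a : K₁} (ha : a ∈ O.comap f) :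
    (⟨a, ha⟩ : O.comap f) ∈ maximalIdeal (O.comap f) ↔ (⟨f a, ha⟩ : O) ∈ maximalIdeal O := by
  rw [← ValuationSubring.coe_mem_nonunits_iff, ← ValuationSubring.coe_mem_nonunits_iff,
    ValuationSubring.mem_nonunits_iff_or, ValuationSubring.mem_nonunits_iff_or]
  show a = 0 ∨ a⁻¹ ∉ O.comap f ↔ f a = 0 ∨ (f a)⁻¹ ∉ O
  rw [map_eq_zero f, ValuationSubring.mem_comap, map_inv₀]

/-- **Models of a subfield, seen inside `K`.** If `K₁ ⊆ K` is an intermediate field over `k` and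
the restriction `O ∩ K₁` of the valuation ring `O` of `K` is locally uniformizable over `k`, then
there is a finitely generated `k`-subalgebra `A₀ ⊆ O ∩ K₁` of `K` with `K₁ ⊆ k(A₀)` whose local
ring at the centre of `O` is regular (it is isomorphic to the local ring of the uniformizing model
of `K₁` at the centre of `O ∩ K₁`). -/
theorem exists_model_of_intermediateField (O : ValuationSubring K) (K₁ : IntermediateField k K)
    (h₁ : IsLocallyUniformizable k K₁ (O.comap (algebraMap K₁ K))) :
    ∃ (A₀ : Subalgebra k K) (h₀ : A₀.toSubring ≤ O.toSubring), A₀.FG ∧ A₀ ≤ K₁.toSubalgebra ∧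
      (K₁ : Set K) ⊆ IntermediateField.adjoin k (A₀ : Set K) ∧
      IsRegularLocalRing (Localization.AtPrime
        (Ideal.comap (Subring.inclusion h₀) (IsLocalRing.maximalIdeal O))) := by
  obtain ⟨A, hA, hfg, hfr, hreg⟩ := h₁
  haveI := hfr
  set f : K₁ →+* K := algebraMap K₁ K with hf
  have hfinj : Function.Injective f := (algebraMap K₁ K).injective
  set A₀ : Subalgebra k K := A.map K₁.val with hA₀
  have hmem : ∀ z : K, z ∈ A₀ ↔ ∃ a ∈ A, f a = z := fun z => Subalgebra.mem_map
  have h₀ : A₀.toSubring ≤ O.toSubring := by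
    intro z hz
    obtain ⟨a, ha, rfl⟩ := (hmem z).mp hz
    exact hA ha
  refine ⟨A₀, h₀, hfg.map _, ?_, ?_, ?_⟩
  · intro z hz
    obtain ⟨a, -, rfl⟩ := (hmem z).mp hz
    exact a.2
  · intro z hz
    obtain ⟨a, b, -, hab⟩ := IsFractionRing.div_surjective (A := A) (⟨z, hz⟩ : K₁)
    have hz' : z = f (algebraMap A K₁ a) / f (algebraMap A K₁ b) := by
      rw [← map_div₀, hab]
      rfl
    rw [hz']
    exact div_mem (IntermediateField.subset_adjoin k _ ((hmem _).mpr ⟨_, a.2, rfl⟩))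
      (IntermediateField.subset_adjoin k _ ((hmem _).mpr ⟨_, b.2, rfl⟩))
  · -- transport of the local ring at the centre along `A ≅ A.map f`
    set S : Subring K := A.toSubring.map f with hS_def
    have hS : S ≤ O.toSubring := by
      rintro z ⟨a, ha, rfl⟩
      exact hA ha
    have e' : A₀.toSubring = S := by
      ext z
      rw [Subalgebra.mem_toSubring, hmem, Subring.mem_map]
      constructor
      · rintro ⟨a, ha, rfl⟩
        exact ⟨a, ha, rfl⟩
      · rintro ⟨a, ha, rfl⟩
        exact ⟨a, ha, rfl⟩
    refine isRegularLocalRing_centre_of_toSubring_eq O A₀ h₀ hS e' ?_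
    let e : A.toSubring ≃+* S := A.toSubring.equivMapOfInjective f hfinj
    set P : Ideal S := Ideal.comap (Subring.inclusion hS) (maximalIdeal O) with hP
    haveI hPp : P.IsPrime := Ideal.comap_isPrime _ _
    refine (isRegularLocalRing_localization_iff_of_ringEquiv e P).mpr ?_
    have hPe : P.comap (e : A.toSubring →+* S) =
        Ideal.comap (Subring.inclusion hA) (maximalIdeal (O.comap f)) := by
      ext a
      have h2 : Subring.inclusion hS (e a) = ⟨f a, hA a.2⟩ :=
        Subtype.ext (Subring.coe_equivMapOfInjective_apply _ f hfinj a)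
      have h3 : Subring.inclusion hA a = ⟨(a : K₁), hA a.2⟩ := rfl
      simp only [Ideal.mem_comap, hP, RingHom.coe_coe]
      rw [h2, h3]
      exact (mk_mem_maximalIdeal_comap_iff O f (hA a.2)).symm
    haveI : (P.comap (e : A.toSubring →+* S)).IsPrime := Ideal.comap_isPrime _ _
    exact isRegularLocalRing_localization_atPrime_congr hPe.symm hreg

/-- **Local uniformization from a subfield plus a purely transcendental part.** If the
restriction `O ∩ K₁` of `O` to an intermediate field `K₁` is locally uniformizable over `k`, and
`K = k(K₁, y₁, …, y_r)` with `trdeg_k K₁ + r ≤ trdeg_k K`, then `O` is locally uniformizable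
over `k`. -/
theorem isLocallyUniformizable_of_intermediateField (O : ValuationSubring K)
    (hO : ∀ c : k, algebraMap k K c ∈ O) (K₁ : IntermediateField k K)
    (h₁ : IsLocallyUniformizable k K₁ (O.comap (algebraMap K₁ K)))
    {r : ℕ} (y : Fin r → K)
    (htop : IntermediateField.adjoin k ((K₁ : Set K) ∪ Set.range y) = ⊤)
    (hdim : Algebra.trdeg k K₁ + r ≤ Algebra.trdeg k K) : IsLocallyUniformizable k K O := by
  obtain ⟨A₀, h₀, hfg, hle, hgen, hreg⟩ := exists_model_of_intermediateField O K₁ h₁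
  refine isLocallyUniformizable_of_adjoin_model O hO A₀ h₀ hfg hreg y ?_ ?_
  · apply top_le_iff.mp
    rw [← htop, IntermediateField.adjoin_le_iff]
    rintro z (hz | ⟨i, rfl⟩)
    · exact IntermediateField.adjoin.mono k _ _ Set.subset_union_left (hgen hz)
    · exact IntermediateField.subset_adjoin k _ (Or.inr ⟨i, rfl⟩)
  · -- `trdeg_k A₀ ≤ trdeg_k K₁` along the inclusion `A₀ ↪ K₁`
    let φ : A₀ →ₐ[k] K₁ :=
      { toFun := fun a => ⟨(a : K), hle a.2⟩
        map_one' := rfl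
        map_zero' := rfl
        map_mul' := fun _ _ => rfl
        map_add' := fun _ _ => rfl
        commutes' := fun _ => rfl }
    have hφ : Function.Injective φ := fun a b hab =>
      Subtype.ext (congrArg (fun z : K₁ => (z : K)) hab)
    exact le_trans (add_le_add (trdeg_le_of_injective φ hφ) le_rfl) hdim

end Transport

/-! ## Restricting a `Lupi` datum and dropping an idle variable -/

section Drop

variable {k K : Type} [Field k] [Field K] [Algebra k K]

/-- **Restriction of a datum to the subfield it generates.** If `x₁ : Fin m → K₁`, `t₁ ∈ K₁`
generate the intermediate field `K₁` over `k`, `x₁` is algebraically independent in `K` and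
`t₁ ^ p ∈ k[x₁]` in `K`, then the same holds inside the field `K₁`, and `k(x₁, t₁) = K₁`. -/
theorem datum_restrict {p m : ℕ} (K₁ : IntermediateField k K) (x₁ : Fin m → K₁) (t₁ : K₁)
    (hK₁ : IntermediateField.adjoin k (insert (t₁ : K) (Set.range fun j => (x₁ j : K))) = K₁)
    (hx : AlgebraicIndependent k fun j => (x₁ j : K))
    (htp : (t₁ : K) ^ p ∈ Algebra.adjoin k (Set.range fun j => (x₁ j : K))) :
    AlgebraicIndependent k x₁ ∧ t₁ ^ p ∈ Algebra.adjoin k (Set.range x₁) ∧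
      IntermediateField.adjoin k (insert t₁ (Set.range x₁)) = ⊤ := by
  have hcomp : (fun j => (x₁ j : K)) = K₁.val ∘ x₁ := rfl
  refine ⟨AlgebraicIndependent.of_comp K₁.val (hcomp ▸ hx), ?_, ?_⟩
  · have hmap : (Algebra.adjoin k (Set.range x₁)).map K₁.val =
        Algebra.adjoin k (Set.range fun j => (x₁ j : K)) := by
      rw [AlgHom.map_adjoin, ← Set.range_comp]
      rfl
    have ht' : (t₁ : K) ^ p ∈ (Algebra.adjoin k (Set.range x₁)).map K₁.val := by
      rw [hmap]; exact htp
    obtain ⟨b, hb, hbt⟩ := Subalgebra.mem_map.mp ht'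
    have hbeq : b = t₁ ^ p := by
      apply Subtype.val_injective
      rw [SubmonoidClass.coe_pow]
      exact hbt
    rw [← hbeq]
    exact hb
  · apply IntermediateField.lift_injective K₁
    rw [IntermediateField.lift_adjoin, IntermediateField.lift_top, Set.image_insert_eq,
      ← Set.range_comp]
    exact hK₁

/-- **Dropping an idle variable.** Let `(x, t)` be a `Lupi` datum of `K/k` in `n + 1` variables
with `t ^ p ∈ k[x_i, i ≠ i₀]`.  If `Lupi` holds for data in `n` variables (over the same `k`, for
every field), then `O` is locally uniformizable over `k`: restrict to
`K₁ = k(x_i, i ≠ i₀; t)` and ascend along the transcendental `x_{i₀}`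
(`isLocallyUniformizable_of_intermediateField`). -/
theorem isLocallyUniformizable_of_drop {p : ℕ} (hp : p ≠ 0) {n : ℕ} (x : Fin (n + 1) → K)
    (t : K) (hx : AlgebraicIndependent k x) (i₀ : Fin (n + 1))
    (htp : t ^ p ∈ Algebra.adjoin k (x '' ({i₀}ᶜ : Set (Fin (n + 1)))))
    (htop : IntermediateField.adjoin k (insert t (Set.range x)) = ⊤)
    (O : ValuationSubring K) (hO : ∀ c : k, algebraMap k K c ∈ O)
    (IH : ∀ (K₁ : Type) [Field K₁] [Algebra k K₁] (x₁ : Fin n → K₁) (t₁ : K₁),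
      AlgebraicIndependent k x₁ → t₁ ^ p ∈ Algebra.adjoin k (Set.range x₁) →
      IntermediateField.adjoin k (insert t₁ (Set.range x₁)) = ⊤ →
      ∀ O₁ : ValuationSubring K₁, (∀ c : k, algebraMap k K₁ c ∈ O₁) →
        IsLocallyUniformizable k K₁ O₁) :
    IsLocallyUniformizable k K O := by
  classical
  -- the idle variable and the others
  set x' : Fin n → K := x ∘ i₀.succAbove with hx'
  have hximg : x '' ({i₀}ᶜ : Set (Fin (n + 1))) = Set.range x' := by
    rw [hx', Set.range_comp, Fin.range_succAbove]
  rw [hximg] at htp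
  have hx'ind : AlgebraicIndependent k x' := hx.comp _ Fin.succAbove_right_injective
  -- the subfield `K₁ = k(x', t)` and the restricted datum
  let K₁ : IntermediateField k K := IntermediateField.adjoin k (insert t (Set.range x'))
  have hx'K₁ : ∀ j, x' j ∈ K₁ := fun j =>
    IntermediateField.subset_adjoin k _ (Set.mem_insert_of_mem _ ⟨j, rfl⟩)
  have htK₁ : t ∈ K₁ := IntermediateField.subset_adjoin k _ (Set.mem_insert _ _)
  let x₁ : Fin n → K₁ := fun j => ⟨x' j, hx'K₁ j⟩
  let t₁ : K₁ := ⟨t, htK₁⟩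
  obtain ⟨hx₁, htp₁, htop₁⟩ := datum_restrict (p := p) K₁ x₁ t₁ rfl hx'ind htp
  -- the restricted valuation ring `O ∩ K₁`
  have hO₁ : ∀ c : k, algebraMap k K₁ c ∈ O.comap (algebraMap K₁ K) := fun c => by
    rw [ValuationSubring.mem_comap, ← IsScalarTower.algebraMap_apply]
    exact hO c
  have h₁ : IsLocallyUniformizable k K₁ (O.comap (algebraMap K₁ K)) :=
    IH K₁ x₁ t₁ hx₁ htp₁ htop₁ _ hO₁
  -- ascend along `x i₀`
  refine isLocallyUniformizable_of_intermediateField O hO K₁ h₁ (r := 1) (fun _ => x i₀) ?_ ?_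
  · apply top_le_iff.mp
    rw [← htop, IntermediateField.adjoin_le_iff]
    rintro z (rfl | ⟨i, rfl⟩)
    · exact IntermediateField.subset_adjoin k _ (Or.inl htK₁)
    · rcases Fin.eq_self_or_eq_succAbove i₀ i with rfl | ⟨j, rfl⟩
      · exact IntermediateField.subset_adjoin k _ (Or.inr ⟨0, rfl⟩)
      · exact IntermediateField.subset_adjoin k _ (Or.inl (hx'K₁ j))
  · have htpx : t ^ p ∈ Algebra.adjoin k (Set.range x) :=
      Algebra.adjoin_mono (Set.range_comp_subset_range _ _) htp
    have hKn : Algebra.trdeg k K = (n + 1 : ℕ) := trdeg_eq x t hp hx htpx htop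
    have hK₁n : Algebra.trdeg k K₁ = n := trdeg_eq x₁ t₁ hp hx₁ htp₁ htop₁
    rw [hKn, hK₁n]
    exact_mod_cast le_refl (n + 1)

end Drop

end Summit.ResolutionOfSingularities.ResolutionOfSingularities.Theorems.Lupi
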